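import Summits.CriticalPhenomena.PercolationContinuityZ3.Theorems.PercNearOneGluingNoHeavyLowerTailSahiC4CubeCertCheck
import Summits.CriticalPhenomena.PercolationContinuityZ3.Theorems.PercNearOneGluingNoHeavyLowerTailSahiC3CubeEvents
import Literature.Probability.LatticeModels.SahiFourthOrderCorrelation

/-!
# `NoHeavyLowerTail` (crux stmt-CriticalPhenomena-4575), master-family hierarchy P3: from the level-4 cube certificate to
# Sahi's inequality `E₄ ≥ 0` for increasing events of `Set (Fin m)` under `prodBernoulli` — the bridge

Support file (seat `prim-masterthm-p3`; `--supports stmt-CriticalPhenomena-4575`).  Continues `…SahiC4CubeCertCheck` (four-copy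
digit test `checkQuad`, cube check `checkCube4`) exactly as `…SahiC3CubeEvents` continues the three-copy checker: with the event
encoding `encA`, `real_eq_ML_cube` (Russo's cylinder formula) and `encA_mem_upsN` of that file,

* `sahiE4_comm₂₃`, `sahiE4_comm₃₄` — the remaining transpositions of `E₄`'s symmetry (`sahiE4_comm₁₂` is in
  `Literature.Probability.LatticeModels.SahiFourthOrderCorrelation`);
* `sahiE4_nonneg_of_checkQuad` — `E₄ ≥ 0` for four events whose bitmasks pass the digit test, under every product measure;
* `forall_of_sorted₄` — a symmetric 4-ary predicate holds everywhere once it holds on quadruples sorted by a key;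
* **`sahiE4_nonneg_of_checkCube4`** — if `checkCube4 m σ = true` then `0 ≤ sahiE4 (prodBernoulli p) A B C D` for every
  `p : Fin m → [0,1]` and all increasing `A B C D : Set (Set (Fin m))` (Sahi 2008 Conj. 5 at order four / the master-family row
  (M-4) of MASTER-FAMILY.md §MASTER, restricted to `{0,1}^m`).

Evaluations: `…SahiC4CubeLeThree`.  Nothing is asserted about the crux.
-/

namespace Summit.CriticalPhenomena.PercolationContinuityZ3.Theorems.SahiC4Cube

open Finset MeasureTheory OneCutCert FourCopyCert SahiC3Cube
open scoped BigOperators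
open Literature.Probability.Percolation Literature.Probability.LatticeModels

/-! ## Symmetry of `E₄` -/

/-- `E₄` is symmetric under exchanging its second and third arguments. [this work] -/
theorem sahiE4_comm₂₃ {Ω : Type*} [MeasurableSpace Ω] (μ : Measure Ω) (A B C D : Set Ω) :
    sahiE4 μ A B C D = sahiE4 μ A C B D := by
  simp only [sahiE4_def, Set.inter_comm, Set.inter_left_comm]
  ring

/-- `E₄` is symmetric under exchanging its third and fourth arguments. [this work] -/
theorem sahiE4_comm₃₄ {Ω : Type*} [MeasurableSpace Ω] (μ : Measure Ω) (A B C D : Set Ω) :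
    sahiE4 μ A B C D = sahiE4 μ A B D C := by
  simp only [sahiE4_def, Set.inter_comm, Set.inter_left_comm]
  ring

/-! ## From the check to Sahi's inequality -/

/-- `E₄ ≥ 0` for four events whose bitmasks pass `checkQuad`, under every product measure. [this work] -/
theorem sahiE4_nonneg_of_checkQuad {m σ : ℕ} (p : Fin m → unitInterval) {A B C D : Set (Set (Fin m))}
    (h : checkQuad σ m (encA m A) (encA m B) (encA m C) (encA m D) = true) :
    0 ≤ sahiE4 (prodBernoulli p) A B C D := by
  classical
  have hx : InCube (fun i => (p i : ℝ)) := fun i => ⟨(p i).2.1, (p i).2.2⟩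
  have key := checkQuad_sound h hx
  have e : ∀ X : Set (Set (Fin m)), (prodBernoulli p).real X = ML (tabR m (encA m X)) (fun i => (p i : ℝ)) :=
    real_eq_ML_cube p
  rw [sahiE4_def]
  simp only [e]
  simp only [tabR_encA_inter, tabR_land] at key ⊢
  exact key

/-- A symmetric 4-ary predicate holds everywhere once it holds on quadruples sorted by a key `f`. [folklore] -/
theorem forall_of_sorted₄ {α : Type*} (P : α → α → α → α → Prop) (f : α → ℕ)
    (h12 : ∀ a b c d, P a b c d → P b a c d) (h23 : ∀ a b c d, P a b c d → P a c b d)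
    (h34 : ∀ a b c d, P a b c d → P a b d c)
    (h : ∀ a b c d, f a ≤ f b → f b ≤ f c → f c ≤ f d → P a b c d) (a b c d : α) : P a b c d := by
  classical
  -- step 1: if `a` is minimal, sort the remaining three with `forall_of_sorted`
  have step : ∀ a b c d, f a ≤ f b → f a ≤ f c → f a ≤ f d → P a b c d := by
    intro a b c d hab hac had
    let Q : α → α → α → Prop := fun x y z => f a ≤ f x → f a ≤ f y → f a ≤ f z → P a x y z
    have hQ : Q b c d := by
      refine forall_of_sorted Q f ?_ ?_ ?_ b c d
      · intro x y z hxyz hy hx hz; exact h23 _ _ _ _ (hxyz hx hy hz)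
      · intro x y z hxyz hx hz hy; exact h34 _ _ _ _ (hxyz hx hy hz)
      · intro x y z hxy hyz hx _ _; exact h a x y z hx hxy hyz
    exact hQ hab hac had
  -- step 2: bring a minimiser of `f` to the front
  obtain ⟨x, hxmem, hxmin⟩ := ({a, b, c, d} : Finset α).exists_min_image f ⟨a, by simp⟩
  have ha : f x ≤ f a := hxmin a (by simp)
  have hb : f x ≤ f b := hxmin b (by simp)
  have hc : f x ≤ f c := hxmin c (by simp)
  have hd : f x ≤ f d := hxmin d (by simp)
  simp only [Finset.mem_insert, Finset.mem_singleton] at hxmem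
  rcases hxmem with rfl | rfl | rfl | rfl
  · exact step x b c d hb hc hd
  · exact h12 _ _ _ _ (step x a c d ha hc hd)
  · exact h23 _ _ _ _ (h12 _ _ _ _ (step x a b d ha hb hd))
  · exact h34 _ _ _ _ (h23 _ _ _ _ (h12 _ _ _ _ (step x a b c ha hb hc)))

/-- **Sahi's `E₄ ≥ 0` on the whole cube `Set (Fin m)` from the level-4 cube check**: if `checkCube4 m σ = true` then for
every `p : Fin m → [0,1]` and all increasing `A, B, C, D`, `0 ≤ E₄(A,B,C,D)` under `prodBernoulli p`. [this work] -/
theorem sahiE4_nonneg_of_checkCube4 {m σ : ℕ} (h : checkCube4 m σ = true) (p : Fin m → unitInterval)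
    {A B C D : Set (Set (Fin m))} (hA : IsUpperSet A) (hB : IsUpperSet B) (hC : IsUpperSet C) (hD : IsUpperSet D) :
    0 ≤ sahiE4 (prodBernoulli p) A B C D := by
  let P : {X : Set (Set (Fin m)) // IsUpperSet X} → {X : Set (Set (Fin m)) // IsUpperSet X} →
      {X : Set (Set (Fin m)) // IsUpperSet X} → {X : Set (Set (Fin m)) // IsUpperSet X} → Prop :=
    fun a b c d => 0 ≤ sahiE4 (prodBernoulli p) a.1 b.1 c.1 d.1
  have key : P ⟨A, hA⟩ ⟨B, hB⟩ ⟨C, hC⟩ ⟨D, hD⟩ := by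
    refine forall_of_sorted₄ P (fun a => encA m a.1) ?_ ?_ ?_ ?_ ⟨A, hA⟩ ⟨B, hB⟩ ⟨C, hC⟩ ⟨D, hD⟩
    · intro a b c d habcd; simp only [P] at habcd ⊢; rwa [sahiE4_comm₁₂]
    · intro a b c d habcd; simp only [P] at habcd ⊢; rwa [sahiE4_comm₂₃]
    · intro a b c d habcd; simp only [P] at habcd ⊢; rwa [sahiE4_comm₃₄]
    · intro a b c d hab hbc hcd
      exact sahiE4_nonneg_of_checkQuad p (checkQuad_of_checkCube4 h (encA_mem_upsN a.2) (encA_mem_upsN b.2)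
        (encA_mem_upsN c.2) (encA_mem_upsN d.2) hab hbc hcd)
  exact key

end Summit.CriticalPhenomena.PercolationContinuityZ3.Theorems.SahiC4Cube
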